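import Mathlib
import Summits.ValiantsHypothesis.ValiantsHypothesis.Theorems.NewtonUnitEquationsDissociatedUniformTotalsLaw
import Summits.ValiantsHypothesis.ValiantsHypothesis.Theorems.NewtonUnitEquationsDissociatedUniformTotalsLawUnion
import Literature.Computability.AlgebraicComplexity.NewtonPolygonTauProductBounds
import HarnessLib

/-!
# Crux `NewtonUnitEquations.DissociatedUniform` (stmt-ValiantsHypothesis-5905): the union-of-fibres totals law IS the two-valued stratum of the `n = 3` law

Companion of `…DissociatedUniformTotalsLawUnion` (`U_s(Z) = ⋃_{z∈Z} P_{s-z}`, `unionTotal a b Z = ∑_s #vert conv U_s(Z)`,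
`@[conjecture] UnionTotalsLaw C`, `@[conjecture] TwoValuedTotalsLaw C`; proved there: `UnionTotalsLaw C → TwoValuedTotalsLaw (2C)`).
Here the converse direction, by FAR SHIFTS: for a position set `Z` and `L` large put `c_L z = (L, 0)` for `z ∈ Z` and `0`
otherwise.  Class `s` of `(a, b, c_L)` is `U_s(Zᶜ) ∪ ((L,0) + U_s(Z))`, and a vertex `p` of `conv U_s(Z)` exposed by a chart
weight `(1, t)` (KPTT `IsStrictTop`) stays exposed after the shift as soon as `L` exceeds every pairing difference
`⟨(1,t), u - p⟩`, `u ∈ A + B` (the unshifted competitors); vertices exposed by `(-1, t)` use the shift `(-L, 0)`.  One `L`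
(a sum of absolute pairing differences over all classes, points and competitors) serves every class, so

* `unionVert_le_classVert_add`:  `#vert conv U_s(Z) ≤ V_s(a, b, c_L) + V_s(a, b, c_{-L})` for every `s`,
* `unionTotal_le_totalVert_add`: `unionTotal a b Z ≤ T(a, b, c_L) + T(a, b, c_{-L})` (no law assumed), hence
* `unionTotalsLaw_of_twoValuedTotalsLaw : TwoValuedTotalsLaw C → UnionTotalsLaw (2C)` and
  `unionTotalsLaw_of_totalsLawThree : TotalsLawThree C → UnionTotalsLaw (2C)`.

Together with the companion file: `UnionTotalsLaw` and `TwoValuedTotalsLaw` are equivalent up to a factor `2` in the constant —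
the union totals law is exactly the first stratum of the `n = 3` law beyond the constant third curve.  Honest label: location
only; all three laws remain OPEN; nothing here bears on VP ≠ VNP.
[folklore: an exposed point of a finite planar set is a hull vertex; every hull vertex is exposed along one of the two affine
half-charts of weights `(±1, t)` — tree lemma `KPTT.PlanarMinkowski.mem_extremePoints_iff_charts`]
-/

set_option linter.dupNamespace false -- `ValiantsHypothesis.ValiantsHypothesis` (summit = problem) in every name

open scoped BigOperators Pointwise

namespace Summit.ValiantsHypothesis.ValiantsHypothesis.Theorems.NewtonUnitEquationsDissociatedUniform

namespace TotalsLaw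

open Literature.Computability.AlgebraicComplexity.KPTT.PlanarMinkowski

variable {G : Type*} [AddCommGroup G] [Fintype G]

/-! ### Far shifts -/

open Classical in
/-- The two-valued third curve of the far-shift argument: `(L, 0)` on `Z`, `0` elsewhere. -/
noncomputable def farShift (Z : Set G) (L : ℝ) (z : G) : Fin 2 → ℝ :=
  if z ∈ Z then ![L, 0] else 0

omit [AddCommGroup G] [Fintype G] in
/-- `farShift` takes at most the two values `0`, `(L, 0)`. -/
theorem farShift_cases (Z : Set G) (L : ℝ) (z : G) : farShift Z L z = 0 ∨ farShift Z L z = ![L, 0] := by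
  unfold farShift
  split_ifs
  · exact Or.inr rfl
  · exact Or.inl rfl

omit [AddCommGroup G] [Fintype G] in
/-- On `Z` the far shift is `(L, 0)`. -/
theorem farShift_of_mem {Z : Set G} (L : ℝ) {z : G} (hz : z ∈ Z) : farShift Z L z = ![L, 0] := by
  unfold farShift
  rw [if_pos hz]

omit [AddCommGroup G] [Fintype G] in
/-- Off `Z` the far shift vanishes. -/
theorem farShift_of_not_mem {Z : Set G} (L : ℝ) {z : G} (hz : z ∉ Z) : farShift Z L z = 0 := by
  unfold farShift
  rw [if_neg hz]

/-- Pairing with a chart weight: `⟨w, (M, 0)⟩ = w 0 · M`. [folklore] -/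
theorem dotProduct_vec_zero (w : Fin 2 → ℝ) (M : ℝ) : w ⬝ᵥ ![M, 0] = w 0 * M := by
  simp [dotProduct, Fin.sum_univ_two]

section Converse

variable (a b : G → (Fin 2 → ℝ)) (Z : Set G)

/-- Finset model of `U_s(Z)`. -/
noncomputable def unionFin (s : G) : Finset (Fin 2 → ℝ) := (unionPts_finite a b Z s).toFinset

/-- Its carrier is `U_s(Z)`. -/
theorem coe_unionFin (s : G) : (unionFin a b Z s : Set (Fin 2 → ℝ)) = unionPts a b Z s :=
  Set.Finite.coe_toFinset _

open Classical in
/-- A chart weight `(±1, t)` exposing `p` in `U_s(Z)` when there is one (`(1, 0)` otherwise). -/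
noncomputable def chartWt (s : G) (p : Fin 2 → ℝ) : Fin 2 → ℝ :=
  if h : ∃ t : ℝ, IsStrictTop ![1, t] (unionFin a b Z s) p then ![1, Classical.choose h]
  else if h' : ∃ t : ℝ, IsStrictTop ![-1, t] (unionFin a b Z s) p then ![-1, Classical.choose h'] else ![1, 0]

/-- The chosen weight has first coordinate `±1`. -/
theorem chartWt_zero (s : G) (p : Fin 2 → ℝ) : chartWt a b Z s p 0 = 1 ∨ chartWt a b Z s p 0 = -1 := by
  unfold chartWt
  split_ifs <;> simp

/-- A hull vertex of `U_s(Z)` is the strict top of `U_s(Z)` for its chosen weight (vertex charts). -/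
theorem isStrictTop_chartWt (s : G) {p : Fin 2 → ℝ}
    (hp : p ∈ (convexHull ℝ (unionPts a b Z s)).extremePoints ℝ) : IsStrictTop (chartWt a b Z s p) (unionFin a b Z s) p := by
  rw [← coe_unionFin a b Z s] at hp
  have hcharts := mem_extremePoints_iff_charts.1 hp
  unfold chartWt
  by_cases h : ∃ t : ℝ, IsStrictTop ![1, t] (unionFin a b Z s) p
  · rw [dif_pos h]
    exact Classical.choose_spec h
  · rw [dif_neg h]
    have h' : ∃ t : ℝ, IsStrictTop ![-1, t] (unionFin a b Z s) p := hcharts.resolve_left h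
    rw [dif_pos h']
    exact Classical.choose_spec h'

/-- Finset model of the full pair sumset `A + B` (the unshifted competitors). -/
noncomputable def pairFin : Finset (Fin 2 → ℝ) :=
  Finset.univ.image fun xy : G × G => a xy.1 + b xy.2

/-- **The common shift size**: one plus the sum, over all classes `s`, points `p ∈ U_s(Z)` and competitors `u ∈ A + B`, of the
absolute pairing differences `|⟨w_{s,p}, u⟩ - ⟨w_{s,p}, p⟩|`. -/
noncomputable def bigL : ℝ :=
  1 + ∑ s, ∑ p ∈ unionFin a b Z s, ∑ u ∈ pairFin a b, |chartWt a b Z s p ⬝ᵥ u - chartWt a b Z s p ⬝ᵥ p|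

/-- Every single pairing difference is below the common shift size. -/
theorem sub_lt_bigL (s : G) {p u : Fin 2 → ℝ} (hp : p ∈ unionFin a b Z s) (hu : u ∈ pairFin a b) :
    chartWt a b Z s p ⬝ᵥ u - chartWt a b Z s p ⬝ᵥ p < bigL a b Z := by
  unfold bigL
  have h1 : |chartWt a b Z s p ⬝ᵥ u - chartWt a b Z s p ⬝ᵥ p| ≤
      ∑ u ∈ pairFin a b, |chartWt a b Z s p ⬝ᵥ u - chartWt a b Z s p ⬝ᵥ p| :=
    Finset.single_le_sum (f := fun u => |chartWt a b Z s p ⬝ᵥ u - chartWt a b Z s p ⬝ᵥ p|)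
      (fun _ _ => abs_nonneg _) hu
  have h2 : ∑ u ∈ pairFin a b, |chartWt a b Z s p ⬝ᵥ u - chartWt a b Z s p ⬝ᵥ p| ≤
      ∑ p ∈ unionFin a b Z s, ∑ u ∈ pairFin a b, |chartWt a b Z s p ⬝ᵥ u - chartWt a b Z s p ⬝ᵥ p| :=
    Finset.single_le_sum (f := fun p => ∑ u ∈ pairFin a b, |chartWt a b Z s p ⬝ᵥ u - chartWt a b Z s p ⬝ᵥ p|)
      (fun _ _ => Finset.sum_nonneg fun _ _ => abs_nonneg _) hp
  have h3 : ∑ p ∈ unionFin a b Z s, ∑ u ∈ pairFin a b, |chartWt a b Z s p ⬝ᵥ u - chartWt a b Z s p ⬝ᵥ p| ≤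
      ∑ s, ∑ p ∈ unionFin a b Z s, ∑ u ∈ pairFin a b, |chartWt a b Z s p ⬝ᵥ u - chartWt a b Z s p ⬝ᵥ p| :=
    Finset.single_le_sum
      (f := fun s => ∑ p ∈ unionFin a b Z s, ∑ u ∈ pairFin a b, |chartWt a b Z s p ⬝ᵥ u - chartWt a b Z s p ⬝ᵥ p|)
      (fun _ _ => Finset.sum_nonneg fun _ _ => Finset.sum_nonneg fun _ _ => abs_nonneg _) (Finset.mem_univ s)
  linarith [le_abs_self (chartWt a b Z s p ⬝ᵥ u - chartWt a b Z s p ⬝ᵥ p)]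

/-- Finset model of a class. -/
noncomputable def classFin (c : G → (Fin 2 → ℝ)) (s : G) : Finset (Fin 2 → ℝ) :=
  Finset.univ.image fun xy : G × G => a xy.1 + b xy.2 + c (s - xy.1 - xy.2)

/-- Its carrier is the class. -/
theorem coe_classFin (c : G → (Fin 2 → ℝ)) (s : G) : (classFin a b c s : Set (Fin 2 → ℝ)) = classPts a b c s := by
  unfold classFin classPts
  rw [Finset.coe_image, Finset.coe_univ, Set.image_univ]

/-- **Far shifts keep exposed vertices exposed.**  If `p` is a hull vertex of `U_s(Z)` whose chosen chart weight has first
coordinate `σ = ±1`, then `(σ·L, 0) + p` is a hull vertex of the class `s` of `(a, b, farShift Z (σ·L))`, `L = bigL`: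
against shifted competitors by translation, against unshifted ones because `⟨w, (σL, 0)⟩ = L` beats every pairing
difference. -/
theorem vadd_mem_extremePoints_classPts {σ : ℝ} (hσ : σ = 1 ∨ σ = -1) (s : G) {p : Fin 2 → ℝ}
    (hp : p ∈ (convexHull ℝ (unionPts a b Z s)).extremePoints ℝ) (h0 : chartWt a b Z s p 0 = σ) :
    ![σ * bigL a b Z, 0] + p ∈ (convexHull ℝ (classPts a b (farShift Z (σ * bigL a b Z)) s)).extremePoints ℝ := by
  set w := chartWt a b Z s p with hw_def
  set v : Fin 2 → ℝ := ![σ * bigL a b Z, 0] with hv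
  have hw : IsStrictTop w (unionFin a b Z s) p := isStrictTop_chartWt a b Z s hp
  have hσσ : σ * σ = 1 := by rcases hσ with rfl | rfl <;> norm_num
  have hwv : w ⬝ᵥ v = bigL a b Z := by
    rw [hv, dotProduct_vec_zero, h0, ← mul_assoc, hσσ, one_mul]
  have hpU : p ∈ unionFin a b Z s := hw.mem
  have hpU' : p ∈ unionPts a b Z s := by
    rw [← coe_unionFin a b Z s]
    exact hpU
  obtain ⟨x₀, y₀, hxy₀, hp₀⟩ := mem_unionPts.1 hpU'
  have htop : IsStrictTop w (classFin a b (farShift Z (σ * bigL a b Z)) s) (v + p) := by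
    refine ⟨Finset.mem_image.2 ⟨(x₀, y₀), Finset.mem_univ _, ?_⟩, fun y hy hne => ?_⟩
    · rw [farShift_of_mem _ hxy₀, hp₀, ← hv]
      abel
    · obtain ⟨⟨x, y⟩, -, rfl⟩ := Finset.mem_image.1 hy
      by_cases hz : s - x - y ∈ Z
      · -- a shifted competitor: translation of a point of `U_s(Z)` other than `p`
        have hu : a x + b y ∈ unionFin a b Z s := by
          rw [← Finset.mem_coe, coe_unionFin]
          exact mem_unionPts.2 ⟨x, y, hz, rfl⟩
        have hne' : a x + b y ≠ p := by
          intro h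
          apply hne
          simp only
          rw [farShift_of_mem _ hz, h, ← hv, add_comm]
        have hlt := hw.lt hu hne'
        simp only
        rw [farShift_of_mem _ hz, ← hv, dotProduct_add w (a x + b y) v, dotProduct_add w v p]
        linarith
      · -- an unshifted competitor: beaten by the size of the shift
        have hu : a x + b y ∈ pairFin a b := Finset.mem_image.2 ⟨(x, y), Finset.mem_univ _, rfl⟩
        have hlt := sub_lt_bigL a b Z s hpU hu
        rw [← hw_def] at hlt
        simp only
        rw [farShift_of_not_mem _ hz, add_zero, dotProduct_add w v p, hwv]
        linarith
  have := htop.mem_extremePoints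
  rwa [coe_classFin] at this

/-- **`#vert conv U_s(Z) ≤ V_s(a,b,c_L) + V_s(a,b,c_{-L})`** with the far shifts `c_{±L} = farShift Z (±bigL)`: every vertex is
exposed along a `(1,t)`- or a `(-1,t)`-chart, and the corresponding shift keeps it exposed in the corresponding class. -/
theorem unionVert_le_classVert_add (s : G) :
    unionVert a b Z s ≤ classVert a b (farShift Z (1 * bigL a b Z)) s + classVert a b (farShift Z (-1 * bigL a b Z)) s := by
  set E := (convexHull ℝ (unionPts a b Z s)).extremePoints ℝ with hE
  set Ep := {p ∈ E | chartWt a b Z s p 0 = 1} with hEp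
  set Em := {p ∈ E | chartWt a b Z s p 0 = -1} with hEm
  have hEfin : E.Finite := (unionPts_finite a b Z s).subset extremePoints_convexHull_subset
  have hcover : E ⊆ Ep ∪ Em := by
    intro p hp
    rcases chartWt_zero a b Z s p with h | h
    · exact Or.inl ⟨hp, h⟩
    · exact Or.inr ⟨hp, h⟩
  have hfinE : ∀ (c : G → (Fin 2 → ℝ)), ((convexHull ℝ (classPts a b c s)).extremePoints ℝ).Finite :=
    fun c => (Set.finite_range _).subset extremePoints_convexHull_subset
  have hp : Ep.ncard ≤ classVert a b (farShift Z (1 * bigL a b Z)) s := by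
    unfold classVert
    refine Set.ncard_le_ncard_of_injOn (fun p => ![1 * bigL a b Z, 0] + p) (fun p hp => ?_)
      (fun p _ p' _ h => add_left_cancel h) (hfinE _)
    exact vadd_mem_extremePoints_classPts a b Z (Or.inl rfl) s hp.1 hp.2
  have hm : Em.ncard ≤ classVert a b (farShift Z (-1 * bigL a b Z)) s := by
    unfold classVert
    refine Set.ncard_le_ncard_of_injOn (fun p => ![-1 * bigL a b Z, 0] + p) (fun p hp => ?_)
      (fun p _ p' _ h => add_left_cancel h) (hfinE _)
    exact vadd_mem_extremePoints_classPts a b Z (Or.inr rfl) s hp.1 hp.2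
  unfold unionVert
  rw [← hE]
  calc E.ncard ≤ (Ep ∪ Em).ncard :=
        Set.ncard_le_ncard hcover ((hEfin.subset fun p hp => hp.1).union (hEfin.subset fun p hp => hp.1))
    _ ≤ Ep.ncard + Em.ncard := Set.ncard_union_le _ _
    _ ≤ _ := add_le_add hp hm

/-- **`unionTotal a b Z ≤ T(a,b,c_L) + T(a,b,c_{-L})`** — union totals are dominated by two two-valued class totals, with no
law assumed. -/
theorem unionTotal_le_totalVert_add :
    unionTotal a b Z ≤ totalVert a b (farShift Z (1 * bigL a b Z)) + totalVert a b (farShift Z (-1 * bigL a b Z)) := by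
  unfold unionTotal totalVert
  rw [← Finset.sum_add_distrib]
  exact Finset.sum_le_sum fun s _ => unionVert_le_classVert_add a b Z s

/-- Existence form: some shift size `L` makes the two far-shift class totals dominate the union total. -/
theorem exists_unionTotal_le_totalVert_add :
    ∃ L : ℝ, unionTotal a b Z ≤ totalVert a b (farShift Z L) + totalVert a b (farShift Z (-L)) := by
  refine ⟨1 * bigL a b Z, ?_⟩
  have h := unionTotal_le_totalVert_add a b Z
  rwa [show -(1 * bigL a b Z) = -1 * bigL a b Z by ring]

end Converse

/-! ### The equivalence -/

/-- **`TwoValuedTotalsLaw C → UnionTotalsLaw (2C)`**: the union-of-fibres totals law follows from the `n = 3` law on third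
curves with two values. -/
theorem unionTotalsLaw_of_twoValuedTotalsLaw {C : ℕ} (h : TwoValuedTotalsLaw C) : UnionTotalsLaw (2 * C) := by
  intro H _ _ a b Z
  obtain ⟨L, hL⟩ := exists_unionTotal_le_totalVert_add a b Z
  have h1 := h H a b (farShift Z L) 0 ![L, 0] (farShift_cases Z L)
  have h2 := h H a b (farShift Z (-L)) 0 ![-L, 0] (farShift_cases Z (-L))
  calc unionTotal a b Z ≤ totalVert a b (farShift Z L) + totalVert a b (farShift Z (-L)) := hL
    _ ≤ C * Fintype.card H ^ 2 + C * Fintype.card H ^ 2 := add_le_add h1 h2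
    _ = 2 * C * Fintype.card H ^ 2 := by ring

/-- **`TotalsLawThree C → UnionTotalsLaw (2C)`**: the `n = 3` totals law contains the union-of-fibres totals law. -/
theorem unionTotalsLaw_of_totalsLawThree {C : ℕ} (h : TotalsLawThree C) : UnionTotalsLaw (2 * C) :=
  unionTotalsLaw_of_twoValuedTotalsLaw (twoValuedTotalsLaw_of_totalsLawThree h)

/-- The two located laws are equivalent up to a factor `2` in the constant (summary). -/
theorem unionTotalsLaw_iff_twoValued_upto_two (C : ℕ) :
    (UnionTotalsLaw C → TwoValuedTotalsLaw (2 * C)) ∧ (TwoValuedTotalsLaw C → UnionTotalsLaw (2 * C)) :=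
  ⟨twoValuedTotalsLaw_of_unionTotalsLaw, unionTotalsLaw_of_twoValuedTotalsLaw⟩

end TotalsLaw

end Summit.ValiantsHypothesis.ValiantsHypothesis.Theorems.NewtonUnitEquationsDissociatedUniform
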